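import Summits.BirchSwinnertonDyer.BirchSwinnertonDyer.Theorems.SignedLowerHalvesSmallImageLowerHalfBothSignsRttD2SeqLocalDualO
import Summits.BirchSwinnertonDyer.BirchSwinnertonDyer.Theorems.SignedLowerHalvesSmallImageLowerHalfBothSignsRttCharRoadE2OfLocalisation
import HarnessLib

/-!
# Route `SignedLowerHalves`, crux L `SmallImageLowerHalfBothSigns` (stmt-BirchSwinnertonDyer-23599), line `rtt_w3` v13 — E2, row D2-seq (1′),
# THE GLUE SOCKET: `charRoad_E2_of_localisation` (LEAD, p776213) with its (PT) carriers instantiated BY NAME — `X' := Dψ.X`, `Q := DQ.X`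
# (dual of the saturated transported local condition group), `gX := loc_v^∨` — and `ker gX ≅ (E^{ε}_{sat,v} ⧸ loc_v(Sel))^∨`

WIDTH seat `bsd-line-slh-p3-w3` g20 under LEAD `cruxlead-stmt-BirchSwinnertonDyer-23599` g9/g10 (cell `bsd-ssimc`); BRIEF-E2 rev 3.1 `Lines/rtt_w3-BRIEF-E2-g9b.md` §2 /
rev 3.2 `…-g9c.md` §3 row (1′); sequel of `…RttD2SeqLocalCondition` / `…RttD2SeqLocalDual` / `…RttD2SeqLocalDualO` (parts 1–3). THEOREMS ONLY (no definition, no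
named fact, no `sorry`); nothing about E2 itself is proved: the research inputs (rows (2′), (5′), (6′), (7′)) are HYPOTHESES; crux L, crux M, E2 and BSD remain OPEN
and are proved for NO curve by any of this.
* §10a `gXHom_eq_zero_iff` (`gX x = 0 ↔ DQ.toDual x ∘ loc_v = 0`), ★ `nonempty_ker_gXHom_addEquiv_quotient_dual`: `ker gX ≃+ Hom(E^{ε}_{sat,v} ⧸ loc_v(Sel), ℚ/ℤ)`
  (exactness of `Hom(−, ℚ/ℤ)`, LEAD's `exact_compHom'_addCircle`; the carrier of row (6′b): by Poitou–Tate `E^{ε}_{sat,v} ⧸ loc_v(Sel)` is dual to the image of the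
  global compact classes).
* §10 ★★ `charRoad_E2_of_locSat`: the LEAD's glue `charRoad_E2_of_localisation` with `Q := DQ.X`, `X' := Dψ.X`, `gX := gXLinearMapO` (part 3), the `Λ_𝒪`-structures
  `instX`/`instQ` with their pins (from `exists_moduleO_signedTransportDualDataSat` p776944 / `LocalCondDualData.exists_moduleO` part 3), the scalar towers by
  `isScalarTower_iwasawaAlgebraO_of_smul_eq`; REMAINING binders = exactly the research content of E2 in Kobayashi's architecture: `z ∈ Q` with `gX z = 0` (row (2′)),
  `hK : λ(ker gX ⧸ Λ_𝒪∙z) ≤ λ(Dψ.X ⧸ gX(Q))` (rows (6′)), `Col : Q ≃ₗ[Λ_𝒪] Λ_𝒪` (row (5′)), `hCol` (row (7′)); CONCLUSION = the E2-tail of `stub_charRoad_ns` for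
  `Dψ.X` verbatim.
* §11 THE STUB'S COEFFICIENTS `M = GreenbergSelmer.Cofree θ (padicCoeffField S)`: `nonempty_localCondDualData_cofree` (with `localAction`) /
  `nonempty_localCondDualData_cofree'` (any pinned action) — the glue's `Q` EXISTS with every torsion / stabiliser binder DISCHARGED
  (`GreenbergSelmer.exists_pow_smul_cofree_eq_zero`, `GreenbergSelmer.isOpen_stabilizer_cofree`, `isOpen_stabilizer_of_hres`); ★★ `charRoad_E2_of_locSat_cofree`:
  the socket at the stub's coefficients, remaining binders = the stub's own + place data + `DQ` + pinned `Λ_𝒪`-structures + the four research inputs.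
References: [Kobayashi2003] Thm. 7.3 i), Thm. 1.3; [PollackRubin2004] §6–§7; [Washington1997] §13.2; [Greenberg1989] §1.
-/

set_option autoImplicit false
set_option linter.dupNamespace false -- D-0017: single-problem summit, the namespace repeats the problem name by design
noncomputable section

open scoped Classical
open NumberField IsDedekindDomain Field

universe u

namespace Summit.BirchSwinnertonDyer.BirchSwinnertonDyer.Theorems.SmallImageRttD2Seq

open Literature.NumberTheory.EllipticCurves Literature.NumberTheory.EllipticCurves.Kobayashi2003
  Literature.NumberTheory.EllipticCurves.GreenbergVatsal2000 Literature.NumberTheory.GaloisRepresentations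
  Summit.BirchSwinnertonDyer.BirchSwinnertonDyer.Theorems.SmallImageCharSignedSelmer

/-! ## §10a. `ker gX ≅ (E^{ε}_{sat,v} ⧸ loc_v(Sel))^∨` (Pontryagin duality; the carrier of row (6′b)) -/

section KerDual

variable {K : Type u} [Field K] [NumberField K] {p : ℕ} [Fact p.Prime] {κ : ZpExtension K p} {γ : absoluteGaloisGroup K}
  {M : Type u} [AddCommGroup M] [DistribMulAction (absoluteGaloisGroup K) M] [TopologicalSpace M] [DiscreteTopology M]
  {R : Type*} [Ring R] [Module R M]
  {V : WeierstrassCurve K} {j : V.geomPrimaryTorsion p →+ M} {S₀ : Set (HeightOneSpectrum (𝓞 K))} {ε : ℤˣ}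
  (D : SignedTransportDualDataSat κ γ M R V j S₀ ε)
  {v : HeightOneSpectrum (𝓞 K)} [DistribMulAction (absoluteGaloisGroup (v.adicCompletion K)) M]
  {γv : absoluteGaloisGroup (v.adicCompletion K)} (DQ : LocalCondDualData κ M R V j ε v γv)
  (hres : ∀ (σ : absoluteGaloisGroup (v.adicCompletion K)) (m : M), σ • m = resGalOfEmb (closureEmb (K := K) (v.adicCompletion K)) σ • m)
  (hvp : (p : 𝓞 K) ∈ v.asIdeal)

/-- **`ker gX` = the characters vanishing on `loc_v(Sel)`**: `gX x = 0 ↔ DQ.toDual x ∘ loc_v = 0` (`Dψ.toDual` is injective). [cite: Washington1997, §13.2] -/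
theorem gXHom_eq_zero_iff (x : DQ.X) :
    gXHom D DQ hres hvp x = 0 ↔ ∀ s : signedTransportSelmerInftySat κ M R V j S₀ ε, DQ.toDual x (locSat κ M R V j S₀ ε v hres hvp s) = 0 := by
  constructor
  · intro h s
    rw [← toDual_gXHom_apply, h, map_zero, AddMonoidHom.zero_apply]
  · intro h
    apply D.bijective.1
    rw [map_zero]
    ext s
    rw [toDual_gXHom_apply, h, AddMonoidHom.zero_apply]

/-- ★ **`ker gX ≅ Hom(E^{ε}_{sat,v} ⧸ loc_v(Sel), ℚ/ℤ)`**: the kernel of `gX = loc_v^∨` is the Pontryagin dual of the cokernel of the localisation map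
(`ker(loc_v⋆) = (E ⧸ loc_v(Sel))⋆` by the exactness of `Hom(−, ℚ/ℤ)`, LEAD's `exact_compHom'_addCircle`, and precomposition with the onto `E → E ⧸ loc_v(Sel)` is injective;
transported along the bijection `DQ.toDual`). This is the carrier of row (6′b) of BRIEF-E2 rev 3.2: by Poitou–Tate, `E^{ε}_{sat,v} ⧸ loc_v(Sel)` is dual to the image of
the global compact classes, so `ker gX ⧸ Λ_𝒪∙z ↔ 𝐇¹_Σ ⧸ Λ_𝒪∙ζ`. [cite: Kobayashi2003, Thm. 7.3 i)] [cite: Washington1997, §13.2] -/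
theorem nonempty_ker_gXHom_addEquiv_quotient_dual :
    Nonempty ((gXHom D DQ hres hvp).ker ≃+
      ((localCondInftySat κ M R V j ε v ⧸ (locSat κ M R V j S₀ ε v hres hvp).range) →+ AddCircle (1 : ℚ))) := by
  -- notation
  set loc := locSat κ M R V j S₀ ε v hres hvp with hloc
  let π : localCondInftySat κ M R V j ε v →+ localCondInftySat κ M R V j ε v ⧸ loc.range := QuotientAddGroup.mk' loc.range
  let πd := AddMonoidHom.compHom' (P := AddCircle (1 : ℚ)) π
  have hinj : Function.Injective πd := fun χ χ' h ↦ by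
    refine AddMonoidHom.ext fun q ↦ ?_
    obtain ⟨c, rfl⟩ := QuotientAddGroup.mk'_surjective loc.range q
    exact DFunLike.congr_fun h c
  have hexact : Function.Exact πd (AddMonoidHom.compHom' (P := AddCircle (1 : ℚ)) loc) :=
    SmallImageRttCharRoad.exact_compHom'_addCircle loc π fun c ↦ by
      rw [QuotientAddGroup.mk'_apply, QuotientAddGroup.eq_zero_iff, AddMonoidHom.mem_range, Set.mem_range]
  -- `ker gX` corresponds, under `DQ.toDual`, to `ker(loc⋆)`
  have hker : ∀ x : DQ.X, x ∈ (gXHom D DQ hres hvp).ker ↔ DQ.toDual x ∈ (AddMonoidHom.compHom' (P := AddCircle (1 : ℚ)) loc).ker := by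
    intro x
    rw [AddMonoidHom.mem_ker, AddMonoidHom.mem_ker, gXHom_eq_zero_iff]
    constructor
    · intro h; ext s; exact h s
    · intro h s; exact DFunLike.congr_fun h s
  let f : (gXHom D DQ hres hvp).ker →+ (AddMonoidHom.compHom' (P := AddCircle (1 : ℚ)) loc).ker :=
    (DQ.toDual.comp (gXHom D DQ hres hvp).ker.subtype).codRestrict _ fun x ↦ (hker x).1 x.2
  have hf : Function.Bijective f := by
    refine ⟨fun x y h ↦ Subtype.ext (DQ.bijective.1 (Subtype.ext_iff.1 h)), fun q ↦ ?_⟩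
    obtain ⟨x, hx⟩ := DQ.bijective.2 (q : localCondInftySat κ M R V j ε v →+ AddCircle (1 : ℚ))
    exact ⟨⟨x, (hker x).2 (hx ▸ q.2)⟩, Subtype.ext hx⟩
  refine ⟨((AddEquiv.ofBijective f hf).trans (AddEquiv.addSubgroupCongr hexact.addMonoidHom_ker_eq)).trans (AddMonoidHom.ofInjective hinj).symm⟩

end KerDual

/-! ## §10. THE GLUE SOCKET: `charRoad_E2_of_localisation` with `Q := DQ.X`, `X' := Dψ.X`, `gX := loc_v^∨` -/

section GlueSocket

open scoped MatrixGroups ModularForm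
open PowerSeries Literature.NumberTheory.IwasawaTheory CongruenceSubgroup Rat.HeightOneSpectrum Literature.NumberTheory.EllipticCurves.ModularForms
  Summit.BirchSwinnertonDyer.BirchSwinnertonDyer.Theorems.SmallImageRttCharRoad

variable {K : Type} [Field K] [NumberField K] {p : ℕ} [Fact p.Prime] {κ : ZpExtension K p} {γ : absoluteGaloisGroup K}
  (S : Set (PadicAlgCl p)) [FiniteDimensional ℚ_[p] (padicCoeffField S)] [Algebra (IwasawaAlgebra p) (IwasawaAlgebraO S)]
  {M : Type} [AddCommGroup M] [DistribMulAction (absoluteGaloisGroup K) M] [TopologicalSpace M] [DiscreteTopology M]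
  [Module (padicCoeffIntegers S) M] [SMulCommClass (absoluteGaloisGroup K) (padicCoeffIntegers S) M]
  {V : WeierstrassCurve K} {j : V.geomPrimaryTorsion p →+ M} {S₀K : Set (HeightOneSpectrum (𝓞 K))} {ε : ℤˣ}
  (D : SignedTransportDualDataSat κ γ M (padicCoeffIntegers S) V j S₀K ε)
  {v : HeightOneSpectrum (𝓞 K)} [DistribMulAction (absoluteGaloisGroup (v.adicCompletion K)) M]
  [SMulCommClass (absoluteGaloisGroup (v.adicCompletion K)) (padicCoeffIntegers S) M]
  {γv : absoluteGaloisGroup (v.adicCompletion K)} (DQ : LocalCondDualData κ M (padicCoeffIntegers S) V j ε v γv)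
  (hres : ∀ (σ : absoluteGaloisGroup (v.adicCompletion K)) (m : M), σ • m = resGalOfEmb (closureEmb (K := K) (v.adicCompletion K)) σ • m)
  (hvp : (p : 𝓞 K) ∈ v.asIdeal)

/-- ★★ **THE GLUE SOCKET.** The LEAD's `charRoad_E2_of_localisation` (p776213) with its (PT) carriers INSTANTIATED BY NAME: `X' := Dψ.X` (the stub's dual, with a
pinned `Λ_𝒪`-structure `instX` from `exists_moduleO_signedTransportDualDataSat`), `Q := DQ.X` (the dual of the saturated transported local condition group, with
`instQ` from `LocalCondDualData.exists_moduleO`), `gX := loc_v^∨ = gXLinearMapO` (`Λ_𝒪`-linear by `gXHom_smul_iwasawaAlgebraO`), the scalar towers from the pins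
(i) by `isScalarTower_iwasawaAlgebraO_of_smul_eq`. What REMAINS as hypotheses is exactly the research content of E2 in Kobayashi's architecture (BRIEF-E2 rev 3.1/3.2):
the zeta element `z ∈ Q` with `gX z = 0` (row (2′): elliptic units + reciprocity), `hK : λ(ker gX ⧸ Λ_𝒪∙z) ≤ λ(Dψ.X ⧸ gX(Q))` (rows (6′)), `Col : Q ≃ₗ[Λ_𝒪] Λ_𝒪` (row
(5′)) and the explicit reciprocity law `hCol` (row (7′)); the conclusion is the E2-tail of `stub_charRoad_ns` for `Dψ.X` VERBATIM. Nothing here proves E2; crux L, crux M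
and BSD remain open and are proved for NO curve. [cite: Kobayashi2003, Thm. 7.3 i), Thm. 1.3] [cite: PollackRubin2004, §6–§7, Theorem (p. 448)] -/
theorem charRoad_E2_of_locSat (hS : 0 < Module.finrank ℚ_[p] (padicCoeffField S))
    (halg : ∀ r : IwasawaAlgebra p, algebraMap (IwasawaAlgebra p) (IwasawaAlgebraO S) r = iwasawaToIwasawaO S r)
    {N : ℕ} [NeZero N] (g : CuspForm (Gamma0 N) 2) (ι : coeffField g →+* PadicAlgCl p) (hng : IsNewform0 g)
    (S₀ : Finset (HeightOneSpectrum (𝓞 ℚ)))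
    [Module.Finite (IwasawaAlgebra p) D.X] (hX : Module.IsTorsion (IwasawaAlgebra p) D.X)
    (instX : Module (IwasawaAlgebraO S) D.X) (instQ : Module (IwasawaAlgebraO S) DQ.X)
    (hιX : ∀ (f : IwasawaAlgebra p) (x : D.X), (letI := instX; iwasawaToIwasawaO S f • x) = f • x)
    (hιQ : ∀ (f : IwasawaAlgebra p) (x : DQ.X), (letI := instQ; iwasawaToIwasawaO S f • x) = f • x)
    (hCX : ∀ (a : padicCoeffIntegers S) (x : D.X) (s : signedTransportSelmerInftySat κ M (padicCoeffIntegers S) V j S₀K ε),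
      D.toDual (letI := instX; (PowerSeries.C a : IwasawaAlgebraO S) • x) s =
        D.toDual x ⟨GreenbergSelmer.scalarH1 κ.kerSubgroup M a s, scalarH1_mem_signedTransportSelmerInftySat κ M (padicCoeffIntegers S) V j S₀K ε a s.2⟩)
    (hCQ : ∀ (a : padicCoeffIntegers S) (x : DQ.X) (c : localCondInftySat κ M (padicCoeffIntegers S) V j ε v),
      DQ.toDual (letI := instQ; (PowerSeries.C a : IwasawaAlgebraO S) • x) c = DQ.toDual x (scalarLocalSat κ M (padicCoeffIntegers S) V j ε v a c))
    (htor : ∀ m : M, ∃ k : ℕ, p ^ k • m = 0)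
    (hstabK : ∀ m : M, IsOpen (MulAction.stabilizer (absoluteGaloisGroup K) m : Set (absoluteGaloisGroup K)))
    (hstab : ∀ m : M, IsOpen (MulAction.stabilizer (absoluteGaloisGroup (v.adicCompletion K)) m : Set (absoluteGaloisGroup (v.adicCompletion K))))
    (hγ : κ.IsTopGenerator γ) (hv : AcSigned.IsNonsplitIn κ v) (hγv : κ.IsTopGenerator (resGalOfEmb (closureEmb (K := K) (v.adicCompletion K)) γv))
    -- the research inputs of E2 (rows (2′), (5′), (6′), (7′) of BRIEF-E2 rev 3.1/3.2)
    (z : DQ.X) (hz : gXHom D DQ hres hvp z = 0)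
    (hK : letI := instX; letI := instQ
      haveI : IsScalarTower (IwasawaAlgebra p) (IwasawaAlgebraO S) D.X := isScalarTower_iwasawaAlgebraO_of_smul_eq S halg hιX
      haveI : IsScalarTower (IwasawaAlgebra p) (IwasawaAlgebraO S) DQ.X := isScalarTower_iwasawaAlgebraO_of_smul_eq S halg hιQ
      lambdaInvariant p (LinearMap.ker (gXLinearMapO S D DQ hres hvp instX instQ hιX hιQ hCX hCQ htor hstabK hstab hγ hv hγv) ⧸
          Submodule.span (IwasawaAlgebraO S)
            {(⟨z, hz⟩ : LinearMap.ker (gXLinearMapO S D DQ hres hvp instX instQ hιX hιQ hCX hCQ htor hstabK hstab hγ hv hγv))}) ≤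
        lambdaInvariant p (D.X ⧸ LinearMap.range (gXLinearMapO S D DQ hres hvp instX instQ hιX hιQ hCX hCQ htor hstabK hstab hγ hv hγv)))
    (Col : letI := instQ; DQ.X ≃ₗ[IwasawaAlgebraO S] IwasawaAlgebraO S)
    (L : IwasawaAlgebraO (Set.range ι)) (hL : L ≠ 0) {c : PadicAlgCl p} (hc : c ≠ 0)
    (fv : HeightOneSpectrum (𝓞 ℚ) → ℤ_[p])
    (hfv : ∀ w ∈ S₀, fv w ≠ 0 ∧ (fv w).valuation = (frobeniusExponent p (natGenerator w : ℤ_[p])).valuation)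
    (hCol : iwasawaOToPowerSeries S ((letI := instQ; Col z)) =
      PowerSeries.C c * iwasawaOToPowerSeries (Set.range ι) L *
        ∏ w ∈ S₀, Polynomial.aeval (PowerSeries.C ((natGenerator w : PadicAlgCl p)⁻¹) *
            (PowerSeries.binomialSeries ℤ_[p] (fv w)).map (algebraMap ℤ_[p] (PadicAlgCl p)))
          (1 - Polynomial.C (embCoeff g ι (natGenerator w)) * Polynomial.X +
            (if natGenerator w ∣ N then 0 else Polynomial.C (natGenerator w : PadicAlgCl p)) * Polynomial.X ^ 2)) :
    ∃ d : ℕ, (∀ k : ℕ, ‖PowerSeries.coeff k (iwasawaOToPowerSeries (Set.range ι) L)‖ ≤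
        ‖PowerSeries.coeff d (iwasawaOToPowerSeries (Set.range ι) L)‖) ∧
      (∀ k : ℕ, k < d → ‖PowerSeries.coeff k (iwasawaOToPowerSeries (Set.range ι) L)‖ <
        ‖PowerSeries.coeff d (iwasawaOToPowerSeries (Set.range ι) L)‖) ∧
      Module.finrank ℚ_[p] (padicCoeffField S) * (d + ∑ w ∈ S₀, p ^ (frobeniusExponent p (natGenerator w : ℤ_[p])).valuation *
        layerLambda ((1 - Polynomial.C (embCoeff g ι (natGenerator w)) * Polynomial.X +
          (if natGenerator w ∣ N then 0 else Polynomial.C (natGenerator w : PadicAlgCl p)) * Polynomial.X ^ 2).comp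
            (Polynomial.C ((natGenerator w : PadicAlgCl p)⁻¹) * (Polynomial.X + 1)))) ≤ lambdaInvariant p D.X := by
  letI := instX; letI := instQ
  haveI : IsScalarTower (IwasawaAlgebra p) (IwasawaAlgebraO S) D.X := isScalarTower_iwasawaAlgebraO_of_smul_eq S halg hιX
  haveI : IsScalarTower (IwasawaAlgebra p) (IwasawaAlgebraO S) DQ.X := isScalarTower_iwasawaAlgebraO_of_smul_eq S halg hιQ
  exact charRoad_E2_of_localisation hS halg g ι hng S₀ hX (gXLinearMapO S D DQ hres hvp instX instQ hιX hιQ hCX hCQ htor hstabK hstab hγ hv hγv)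
    z hz hK Col L hL hc fv hfv hCol

end GlueSocket

/-! ## §11. The stub's coefficients `M = Cofree θ F` (`F = ℚ_p(S)`, `𝒪 = padicCoeffIntegers S`): every local binder DISCHARGED -/

section CofreeCoeff

open scoped MatrixGroups ModularForm
open PowerSeries Literature.NumberTheory.IwasawaTheory CongruenceSubgroup Rat.HeightOneSpectrum Literature.NumberTheory.EllipticCurves.ModularForms
  Summit.BirchSwinnertonDyer.BirchSwinnertonDyer.Theorems.SmallImageRttCharRoad

variable {K : Type} [Field K] [NumberField K] {p : ℕ} [Fact p.Prime] (κ : ZpExtension K p) (S : Set (PadicAlgCl p))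
  (θ : FramedGaloisRep K (padicCoeffIntegers S) 1) (V : WeierstrassCurve K)
  (j : V.geomPrimaryTorsion p →+ GreenbergSelmer.Cofree θ (padicCoeffField S)) (ε : ℤˣ) (v : HeightOneSpectrum (𝓞 K))

/-- **The glue's `Q` EXISTS for the stub's coefficients**: for `M = Cofree θ F = (F/𝒪)(θ)` (the stub's `GreenbergSelmer.Cofree θ (padicCoeffField S)`) with its
`Γ_{K_v}`-action `localAction` (restriction along `res_ι`), `v` non-split in `K_∞/K` and a local topological generator `γ_v`, local dual data `DQ` exist — ALL the
binders of parts 2–3 are discharged: `p`-primarity (`GreenbergSelmer.exists_pow_smul_cofree_eq_zero`), open stabilisers in `Γ_K` (`GreenbergSelmer.isOpen_stabilizer_cofree`)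
descended to `Γ_{K_v}` (`isOpen_stabilizer_of_hres`), `hres` by `rfl`. [cite: Greenberg1989, §1 p. 98] [cite: HatleyLeiVigni2022, §3.1] -/
theorem nonempty_localCondDualData_cofree (hv : AcSigned.IsNonsplitIn κ v) {γv : absoluteGaloisGroup (v.adicCompletion K)}
    (hγv : κ.IsTopGenerator (resGalOfEmb (closureEmb (K := K) (v.adicCompletion K)) γv)) :
    letI := localAction (closureEmb (K := K) (v.adicCompletion K)) (GreenbergSelmer.Cofree θ (padicCoeffField S))
    Nonempty (LocalCondDualData κ (GreenbergSelmer.Cofree θ (padicCoeffField S)) (padicCoeffIntegers S) V j ε v γv) := by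
  letI := localAction (closureEmb (K := K) (v.adicCompletion K)) (GreenbergSelmer.Cofree θ (padicCoeffField S))
  exact ⟨localCondDualData κ _ (padicCoeffIntegers S) V j ε v (GreenbergSelmer.exists_pow_smul_cofree_eq_zero S θ)
    (isOpen_stabilizer_of_hres (GreenbergSelmer.Cofree θ (padicCoeffField S)) v (fun _ _ ↦ rfl) (GreenbergSelmer.isOpen_stabilizer_cofree S θ)) hv hγv⟩

variable {κ S θ V j ε v} in
/-- **Local dual data exist for the stub's coefficients under ANY pinned `Γ_{K_v}`-action** (instance binder + `hres`; e.g. `localAction`, or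
`GreenbergSelmer.instDistribMulActionCofree (θ.restrictField K_v)` on the same carrier): torsion / stabiliser binders discharged as above.
[cite: Greenberg1989, §1 p. 98] [cite: HatleyLeiVigni2022, §3.1] -/
theorem nonempty_localCondDualData_cofree' [DistribMulAction (absoluteGaloisGroup (v.adicCompletion K)) (GreenbergSelmer.Cofree θ (padicCoeffField S))]
    (hres : ∀ (σ : absoluteGaloisGroup (v.adicCompletion K)) (m : GreenbergSelmer.Cofree θ (padicCoeffField S)),
      σ • m = resGalOfEmb (closureEmb (K := K) (v.adicCompletion K)) σ • m)
    (hv : AcSigned.IsNonsplitIn κ v) {γv : absoluteGaloisGroup (v.adicCompletion K)}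
    (hγv : κ.IsTopGenerator (resGalOfEmb (closureEmb (K := K) (v.adicCompletion K)) γv)) :
    Nonempty (LocalCondDualData κ (GreenbergSelmer.Cofree θ (padicCoeffField S)) (padicCoeffIntegers S) V j ε v γv) :=
  ⟨localCondDualData κ _ (padicCoeffIntegers S) V j ε v (GreenbergSelmer.exists_pow_smul_cofree_eq_zero S θ)
    (isOpen_stabilizer_of_hres (GreenbergSelmer.Cofree θ (padicCoeffField S)) v hres (GreenbergSelmer.isOpen_stabilizer_cofree S θ)) hv hγv⟩

variable {κ S θ V j ε v} in
/-- ★★ **THE GLUE SOCKET FOR THE STUB'S COEFFICIENTS.** `charRoad_E2_of_locSat` at `M := Cofree θ F = (F/𝒪)(θ)` (the stub's `GreenbergSelmer.Cofree θ (padicCoeffField S)`),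
for ANY `Γ_{K_v}`-action pinned by `hres` (instance binder; canonical filler `localAction`, `smulCommClass_localAction`): the torsion / stabiliser binders are DISCHARGED
(`GreenbergSelmer.exists_pow_smul_cofree_eq_zero`, `GreenbergSelmer.isOpen_stabilizer_cofree`, `isOpen_stabilizer_of_hres`). Remaining: the stub's own binders (`Dψ`,
`Module.Finite`, `IsTorsion`, `γ`, `0 < [ℚ_p(S):ℚ_p]`), the place data (`v ∣ p` non-split in `K_∞`, a local generator `γ_v` — exists, `exists_isTopGenerator_resGalOfEmb`),
a local dual datum `DQ` (exists, `nonempty_localCondDualData_cofree'`), pinned `Λ_𝒪`-structures (exist: p776944 / `LocalCondDualData.exists_moduleO`), and the FOUR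
RESEARCH INPUTS `z`/`hz` (row (2′)), `hK` (rows (6′)), `Col` (row (5′)), `hCol` (row (7′)). Conclusion = the E2-tail of `stub_charRoad_ns` for `Dψ.X` verbatim.
Nothing here proves E2; crux L, crux M and BSD remain open and are proved for NO curve. [cite: Kobayashi2003, Thm. 7.3 i), Thm. 1.3] [cite: PollackRubin2004, §6–§7, Theorem (p. 448)] -/
theorem charRoad_E2_of_locSat_cofree [FiniteDimensional ℚ_[p] (padicCoeffField S)] [Algebra (IwasawaAlgebra p) (IwasawaAlgebraO S)]
    [DistribMulAction (absoluteGaloisGroup (v.adicCompletion K)) (GreenbergSelmer.Cofree θ (padicCoeffField S))]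
    [SMulCommClass (absoluteGaloisGroup (v.adicCompletion K)) (padicCoeffIntegers S) (GreenbergSelmer.Cofree θ (padicCoeffField S))]
    (hres : ∀ (σ : absoluteGaloisGroup (v.adicCompletion K)) (m : GreenbergSelmer.Cofree θ (padicCoeffField S)),
      σ • m = resGalOfEmb (closureEmb (K := K) (v.adicCompletion K)) σ • m)
    (hS : 0 < Module.finrank ℚ_[p] (padicCoeffField S))
    (halg : ∀ r : IwasawaAlgebra p, algebraMap (IwasawaAlgebra p) (IwasawaAlgebraO S) r = iwasawaToIwasawaO S r)
    {N : ℕ} [NeZero N] (g : CuspForm (Gamma0 N) 2) (ι : coeffField g →+* PadicAlgCl p) (hng : IsNewform0 g)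
    (S₀ : Finset (HeightOneSpectrum (𝓞 ℚ))) {S₀K : Set (HeightOneSpectrum (𝓞 K))} {γ : absoluteGaloisGroup K}
    (D : SignedTransportDualDataSat κ γ (GreenbergSelmer.Cofree θ (padicCoeffField S)) (padicCoeffIntegers S) V j S₀K ε)
    [Module.Finite (IwasawaAlgebra p) D.X] (hX : Module.IsTorsion (IwasawaAlgebra p) D.X) (hγ : κ.IsTopGenerator γ)
    (hvp : (p : 𝓞 K) ∈ v.asIdeal) (hv : AcSigned.IsNonsplitIn κ v) {γv : absoluteGaloisGroup (v.adicCompletion K)}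
    (hγv : κ.IsTopGenerator (resGalOfEmb (closureEmb (K := K) (v.adicCompletion K)) γv))
    (DQ : LocalCondDualData κ (GreenbergSelmer.Cofree θ (padicCoeffField S)) (padicCoeffIntegers S) V j ε v γv)
    (instX : Module (IwasawaAlgebraO S) D.X) (instQ : Module (IwasawaAlgebraO S) DQ.X)
    (hιX : ∀ (f : IwasawaAlgebra p) (x : D.X), (letI := instX; iwasawaToIwasawaO S f • x) = f • x)
    (hιQ : ∀ (f : IwasawaAlgebra p) (x : DQ.X), (letI := instQ; iwasawaToIwasawaO S f • x) = f • x)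
    (hCX : ∀ (a : padicCoeffIntegers S) (x : D.X)
        (s : signedTransportSelmerInftySat κ (GreenbergSelmer.Cofree θ (padicCoeffField S)) (padicCoeffIntegers S) V j S₀K ε),
      D.toDual (letI := instX; (PowerSeries.C a : IwasawaAlgebraO S) • x) s =
        D.toDual x ⟨GreenbergSelmer.scalarH1 κ.kerSubgroup _ a s, scalarH1_mem_signedTransportSelmerInftySat κ _ (padicCoeffIntegers S) V j S₀K ε a s.2⟩)
    (hCQ : ∀ (a : padicCoeffIntegers S) (x : DQ.X) (c : localCondInftySat κ (GreenbergSelmer.Cofree θ (padicCoeffField S)) (padicCoeffIntegers S) V j ε v),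
        DQ.toDual (letI := instQ; (PowerSeries.C a : IwasawaAlgebraO S) • x) c =
          DQ.toDual x (scalarLocalSat κ (GreenbergSelmer.Cofree θ (padicCoeffField S)) (padicCoeffIntegers S) V j ε v a c))
    -- the research inputs of E2 (rows (2′), (5′), (6′), (7′))
    (z : DQ.X) (hz : gXHom D DQ hres hvp z = 0)
    (hK : letI := instX; letI := instQ
      haveI : IsScalarTower (IwasawaAlgebra p) (IwasawaAlgebraO S) D.X := isScalarTower_iwasawaAlgebraO_of_smul_eq S halg hιX
      haveI : IsScalarTower (IwasawaAlgebra p) (IwasawaAlgebraO S) DQ.X := isScalarTower_iwasawaAlgebraO_of_smul_eq S halg hιQ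
      let gX := gXLinearMapO S D DQ hres hvp instX instQ hιX hιQ hCX hCQ (GreenbergSelmer.exists_pow_smul_cofree_eq_zero S θ)
        (GreenbergSelmer.isOpen_stabilizer_cofree S θ)
        (isOpen_stabilizer_of_hres (GreenbergSelmer.Cofree θ (padicCoeffField S)) v hres (GreenbergSelmer.isOpen_stabilizer_cofree S θ)) hγ hv hγv
      lambdaInvariant p (LinearMap.ker gX ⧸ Submodule.span (IwasawaAlgebraO S) {(⟨z, hz⟩ : LinearMap.ker gX)}) ≤
        lambdaInvariant p (D.X ⧸ LinearMap.range gX))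
    (Col : letI := instQ; DQ.X ≃ₗ[IwasawaAlgebraO S] IwasawaAlgebraO S)
    (L : IwasawaAlgebraO (Set.range ι)) (hL : L ≠ 0) {c : PadicAlgCl p} (hc : c ≠ 0)
    (fv : HeightOneSpectrum (𝓞 ℚ) → ℤ_[p])
    (hfv : ∀ w ∈ S₀, fv w ≠ 0 ∧ (fv w).valuation = (frobeniusExponent p (natGenerator w : ℤ_[p])).valuation)
    (hCol : iwasawaOToPowerSeries S ((letI := instQ; Col z)) =
      PowerSeries.C c * iwasawaOToPowerSeries (Set.range ι) L *
        ∏ w ∈ S₀, Polynomial.aeval (PowerSeries.C ((natGenerator w : PadicAlgCl p)⁻¹) *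
            (PowerSeries.binomialSeries ℤ_[p] (fv w)).map (algebraMap ℤ_[p] (PadicAlgCl p)))
          (1 - Polynomial.C (embCoeff g ι (natGenerator w)) * Polynomial.X +
            (if natGenerator w ∣ N then 0 else Polynomial.C (natGenerator w : PadicAlgCl p)) * Polynomial.X ^ 2)) :
    ∃ d : ℕ, (∀ k : ℕ, ‖PowerSeries.coeff k (iwasawaOToPowerSeries (Set.range ι) L)‖ ≤
        ‖PowerSeries.coeff d (iwasawaOToPowerSeries (Set.range ι) L)‖) ∧
      (∀ k : ℕ, k < d → ‖PowerSeries.coeff k (iwasawaOToPowerSeries (Set.range ι) L)‖ <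
        ‖PowerSeries.coeff d (iwasawaOToPowerSeries (Set.range ι) L)‖) ∧
      Module.finrank ℚ_[p] (padicCoeffField S) * (d + ∑ w ∈ S₀, p ^ (frobeniusExponent p (natGenerator w : ℤ_[p])).valuation *
        layerLambda ((1 - Polynomial.C (embCoeff g ι (natGenerator w)) * Polynomial.X +
          (if natGenerator w ∣ N then 0 else Polynomial.C (natGenerator w : PadicAlgCl p)) * Polynomial.X ^ 2).comp
            (Polynomial.C ((natGenerator w : PadicAlgCl p)⁻¹) * (Polynomial.X + 1)))) ≤ lambdaInvariant p D.X :=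
  charRoad_E2_of_locSat S D DQ hres hvp hS halg g ι hng S₀ hX instX instQ hιX hιQ hCX hCQ
    (GreenbergSelmer.exists_pow_smul_cofree_eq_zero S θ) (GreenbergSelmer.isOpen_stabilizer_cofree S θ)
    (isOpen_stabilizer_of_hres (GreenbergSelmer.Cofree θ (padicCoeffField S)) v hres (GreenbergSelmer.isOpen_stabilizer_cofree S θ))
    hγ hv hγv z hz hK Col L hL hc fv hfv hCol

end CofreeCoeff

end Summit.BirchSwinnertonDyer.BirchSwinnertonDyer.Theorems.SmallImageRttD2Seq

end
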